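/-
Copyright (c) 2026 the pub-hodgecm-mathlib formalisation cell (harness21).  Prover seat hodgecm-mathlib-R90-C10-p03 (g2), SLAB R90-TF, section S1 «Ch. 10∕12 local»;
crux H413 = `stmt-HodgeConjecture-24833`; line «B_pos» RAMIFIED TAME corner (B-10), card (6d-Rb) «THE `HRb` DISCHARGE SHIM» (dealer R90-C10-plan (g3) ruling R-S1-33 (2),
2026-09-05T02:50:17Z): ★ (6d-R)'s (R-b) letter with its four VALUE LETTERS discharged BY NAME from (6a) PART 3 ∕ (6a-G), every auxiliary choice (Borel structure and
additive Haar measure of `R⁻`, `Invertible 2`) made inside.  KERNEL module: THEOREMS ONLY (no definition, no named fact, no `sorry`, no instance, no notation).  2026-09-05.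
-/
import Summits.HodgeConjecture.HodgeConjecture.Theorems.R90S1BposRamShellLawOfRecord    -- ★ p864649 (6d-R) (this seat): `shellLaw_of_values` (the (R-b) letter over the four value letters); brings ★ (6d), ★ (6e), ★ p863838 (`hfixP` from Branch B)
import Summits.HodgeConjecture.HodgeConjecture.Theorems.R90S1BposRamGaussSphereValues    -- (6a-G)(β) FILE 3 (R90-C10-p04 (g3)): `exists_sphereCrit_sq_mul_eq` (T3), `sphere_family_deep_eq_zero` (T4), `sphere_family_shallow_eq_zero` (T5); brings PART 3 (G3), ★ (G4) p864720, ★ FILE 1 p864713, (G2)-prep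
import HarnessLib

/-!
# R90-TF S1 «Ch10-local» ∕ K2 E3 «U4Keys» :182, BRANCH B AT POSITIVE DEPTH, RAMIFIED TAME corner — card (6d-Rb): THE (R-b) LETTER `HRb` DISCHARGED
# «in sub-branch (R-b) (`hFε`): even cut shells `0`, odd cut shells `C·X^{κ+1}`, `C²·X = (q^ν·μ(B(ν,0)))²·((q−1)²·(q^{2ν+1})⁻¹)` — NO letters left»
# [Keys1984 §4–§5, §7 Thm (2) (d); Casselman1980 §3; Rogawski1990 §1.10, §12.2 (2); IrelandRosen1990 Ch. 8 §2; WeilBNT1967 Ch. II §5]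

Cell `pub/hodgecm-mathlib`, crux H413 = `stmt-HodgeConjecture-24833`, route of record `HCCMUnconditional` (no route verbs); R90-TF section S1 (base R90-C10), dealer
R90-C10-plan (g3) (rulings R-S1-27 «four layers», R-S1-29 «(6a-G) split», R-S1-30∕33 «(S-RT) endgame»), line lead R90-C10-p05 (g2), auditor R90-C10-audit1 (g3).
THEOREMS ONLY; lane `--supports stmt-HodgeConjecture-24833 --as helper`, count-neutral.  NOT THE PAYER of :182: this file is the `HRb` ARGUMENT of ★ (8⁺b)
`R90S1KeysThmTwoPosDepthBranchBRamifiedTameLeafOfRecord.exists_eta_of_reducible_posDepth_normTrivial_ramifiedTame (HRa) (HRb)` (R90-C10-p05 (g2)), binder l. 305–337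
TOKEN FOR TOKEN after `fun w hw _he _h2w _hϖ piU _hpiU _hm _hνν _hcond u₁ _hu₁ _hχu₁ _ _ μ _ hFε => …`; the (S-RT) payer (8⁺c) `…RamifiedTameLeafFinal` applies it so.

THE POINT.  ★ (6d-R) `shellLaw_of_values` is the (R-b) shell law GIVEN the four sphere-value letters of ruling R-S1-29 over an auxiliary regular additive Haar measure `μ⁻` of
`R⁻`: `hΦdeep` (deep levels), `hΦcritC` + `hΦcrit` (the critical value `Φcrit` and its Gauss square), `hΦsh` (shallow levels).  (6a-G)(β) FILE 3 `R90S1BposRamGaussSphereValues`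
(R90-C10-p04 (g3)) proves all four in exactly those shapes: (T4) `sphere_family_deep_eq_zero` (★ PART 3 (G3)), (T3) `exists_sphereCrit_sq_mul_eq` (∃ `Φcrit`: constancy along the
base family ★ FILE 1 (G1)+`hB`, and the Gauss square (T1) = R90-C10-p07 (g2)'s (G2)-prep with its letters paid), (T5) `sphere_family_shallow_eq_zero` (★ (G4) p864720 of
R90-C10-p08 (g2)).  HERE: choose `borel R`, `μ⁻ := Measure.addHaar`, `Invertible 2 := (isUnit_two_localRing L v).invertible`, read `hfixP` off Branch B (★ p863838), `σ½ = ½`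
(★ `HeisRing.map_invOf_two`), `σ(σΠ·Π) = σΠ·Π` (★ (6b) P1 §0′), and compose — ONE `obtain` + ONE `exact`.
* §1 **`shellLaw_of_record`** — over the (8⁺a)∕(8⁺b) frame `(L v w hw) (hns he h2w) {ϖ} (hϖ) (χ₁ h₁ hcontr hB) (piU hpiU) {m ν} (hm hνν) (hcond) (u₁ hu₁ hχu₁) [Borel N] (μ)
  [IsHaarMeasure] (hFε)` ⊢ **`(∀ j₀ j, j₀ ≤ j → Even j → ∫_{Sh_j ∩ cut ν} F₀ dμ = 0) ∧ ∃ C, (∀ j κ, j = 2κ+1 → ∫_{Sh_j ∩ cut ν} F₀ dμ = C·X^{κ+1}) ∧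
  C²·X = (q^ν·μ(B(ν,0)))²·((q−1)²·(q^{2ν+1})⁻¹)`** (★ (6d) §2 ∕ ★ (6d-R) conclusion bytes = p05 (g2)'s `HRb` body VERBATIM).
HONEST LABEL.  HC_CM is proved only modulo the 7 printed citations (2 remaining named inputs: hLiu418 = `stmt-HodgeConjecture-24832`, h413 = `stmt-HodgeConjecture-24833`) until
rung 0 closes; count-neutral — this file pays NO socket by itself ((S-RT) is paid BY NAME only by (8⁺c) and closes only when K2E3's organ edition is WRITTEN + BUILT; :182 ∕ A2′
OPEN); no printed citation is discharged; REL ≠ ★ ≠ BUILT.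

## References
* [Keys1984] D. Keys, *Principal series representations of special unitary groups over local fields*, Compositio Math. 51 (1984), §4–§5, §7 Theorem (2) (d) p. 126.
* [Casselman1980] W. Casselman, *The unramified principal series of p-adic groups I*, Compositio Math. 40 (1980), §3.
* [Rogawski1990] J. D. Rogawski, *Automorphic Representations of Unitary Groups in Three Variables*, Ann. of Math. Stud. 123 (1990), §1.10 p. 9, §12.2 (2) p. 173.
* [IrelandRosen1990] K. Ireland, M. Rosen, *A Classical Introduction to Modern Number Theory*, GTM 84 (1990), Ch. 8 §2 Prop. 8.2.2.
* [WeilBNT1967] A. Weil, *Basic Number Theory* (1967), Ch. I §4, Ch. II §5.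
-/

set_option autoImplicit false
set_option linter.dupNamespace false  -- the mandated namespace has the single-problem summit's repeated segment (`HodgeConjecture.HodgeConjecture`)

noncomputable section

open NumberField IsDedekindDomain MeasureTheory Measure Literature.NumberTheory Literature.NumberTheory.Automorphic Literature.NumberTheory.Automorphic.UnitaryGroup
open scoped Matrix MatrixGroups WithZero Valued NNReal ENNReal

namespace Summit.HodgeConjecture.HodgeConjecture.R90.S1.BposRamShellLawRb

open Summit.HodgeConjecture.HodgeConjecture.Cruxes.H413 Summit.HodgeConjecture.HodgeConjecture.R90.S1

-- the statement carries the frame-v1 Casselman integrand on the matrix-group carrier of `N(L⁺_v)`: generous budgets for the whole module (class of ★ (6d) ∕ ★ (6d-R))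
set_option synthInstance.maxHeartbeats 400000
set_option maxHeartbeats 6000000

variable (L : Type) [Field L] [NumberField L] [IsCMField L] (v : HeightOneSpectrum (𝓞 ↥(maximalRealSubfield L)))
  (w : PlacesOver L v) (hw : IsCMField.complexConj L • w.1 = w.1)

/-! ## §1 The (R-b) letter `HRb`, no letters left -/

open scoped Classical in
include hw in
/-- **THE (R-b) LETTER `HRb` OF ★ (8⁺b), DISCHARGED.**  `v` non-split (`hns`), RAMIFIED at `w` (`he`), TAME (`|2|_w = 1`); `ϖ` a uniformiser of `L_w`; `χ₁ : (L ⊗ L⁺_v)ˣ → ℂˣ`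
continuous (`h₁`), contracting (`hcontr`), in BRANCH B (`hB`: `χ₁(u·σu) = 1` on the units of valuation one); `Π = piU` a uniformiser unit (`|Π_{w′}| = exp(−1)`, ONE CURRENCY
`X := χ₁(σΠ·Π)`); conductor data `1 ≤ m`, `ν + ν = m + 1`, `χ₁ = 1` at level `|ϖ|^{m+1}` (`hcond`) with a level-`m` witness `u₁` (`hu₁`, `hχu₁`); a Haar measure `μ` of
`N(L⁺_v)`; and the sub-branch (R-b) witness `hFε` (a `σ`-fixed unit `a₀` of valuation one with `χ₁ a₀ ≠ 1`, ★ (7)'s spelling).  THEN, with `F₀(n) = χ₁((σẑ)⁻¹)·‖ẑ‖⁻¹`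
(`z = n₀₂`), `Sh_j ∩ cut ν = {|z|_w = eʲ ∧ |x|_w ≤ e^{j−ν}}` (★ (6c) bytes), `q := N𝔓_w`, `B(ν,0) = {|z|_w ≤ |ϖ|⁰ ∧ |x|_w ≤ |ϖ|^ν}`:
**`(∀ j₀ j, j₀ ≤ j → Even j → ∫_{Sh_j ∩ cut ν} F₀ dμ = 0) ∧ ∃ C, (∀ j κ, j = 2κ+1 → ∫_{Sh_j ∩ cut ν} F₀ dμ = C·X^{κ+1}) ∧ C²·X = (q^ν·μ(B(ν,0)))²·((q−1)²·(q^{2ν+1})⁻¹)`**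
— p05 (g2)'s `HRb` body (★ (8⁺b) l. 315–337) VERBATIM.  Proof: `borel R`, `μ⁻ := addHaar`, `Invertible 2`; `hfixP` ★ p863838; `σ½ = ½`; `σ(σΠ·Π) = σΠ·Π` ★ P1 §0′;
`obtain ⟨Φcrit, hΦcritC, hΦcrit⟩ :=` FILE 3 (T3) at `c := ½`; `exact` ★ (6d-R) `shellLaw_of_values` fed (T4), `hΦcritC`, (T5), `hΦcrit`.
[cite: Keys1984, §4–§5, §7 Theorem (2) (d) p. 126] [cite: Casselman1980, §3] [cite: Rogawski1990, §1.10 p. 9, §12.2 (2) p. 173] [cite: IrelandRosen1990, Ch. 8 §2 Prop. 8.2.2]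
[cite: WeilBNT1967, Ch. II §5] -/
theorem shellLaw_of_record (hns : ∀ w' : PlacesOver L v, IsCMField.complexConj L • w'.1 = w'.1)
    (he : v.asIdeal.ramificationIdx' w.1.asIdeal ≠ 1) (h2w : Valued.v (2 : w.1.adicCompletion L) = 1)
    {ϖ : w.1.adicCompletion L} (hϖ : Valued.v ϖ = WithZero.exp (-1 : ℤ))
    (χ₁ : (LocalRing L v)ˣ →* ℂˣ) (h₁ : Continuous fun x => ((χ₁ x : ℂˣ) : ℂ))
    (hcontr : ∀ x : (LocalRing L v)ˣ, unitModulusChar (LocalRing L v) x < 1 → ‖((χ₁ x : ℂˣ) : ℂ)‖ < 1)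
    (hB : ∀ u : (LocalRing L v)ˣ, (∀ w' : PlacesOver L v, Valued.v ((u : LocalRing L v) w') = 1) →
      χ₁ (u * Units.map (conjLocal L (IsCMField.complexConj L) v : LocalRing L v →* LocalRing L v) u) = 1)
    (piU : (LocalRing L v)ˣ) (hpiU : ∀ w' : PlacesOver L v, Valued.v ((piU : LocalRing L v) w') = WithZero.exp (-1 : ℤ))
    {m ν : ℕ} (hm : 1 ≤ m) (hνν : ν + ν = m + 1)
    (hcond : ∀ u : (LocalRing L v)ˣ, (∀ w' : PlacesOver L v, Valued.v (((u : LocalRing L v) w') - 1) ≤ Valued.v ϖ ^ (m + 1)) → χ₁ u = 1)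
    (u₁ : (LocalRing L v)ˣ) (hu₁ : ∀ w' : PlacesOver L v, Valued.v (((u₁ : LocalRing L v) w') - 1) ≤ Valued.v ϖ ^ m) (hχu₁ : χ₁ u₁ ≠ 1)
    [MeasurableSpace ↥(cmBorelTriple L 3 v).N] [BorelSpace ↥(cmBorelTriple L 3 v).N] (μ : Measure ↥(cmBorelTriple L 3 v).N) [μ.IsHaarMeasure]
    (hFε : ∃ a : (LocalRing L v)ˣ, Units.map (conjLocal L (IsCMField.complexConj L) v : LocalRing L v →* LocalRing L v) a = a ∧
      (∀ w' : PlacesOver L v, Valued.v ((a : LocalRing L v) w') = 1) ∧ χ₁ a ≠ 1) :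
    (∀ j₀ j : ℕ, j₀ ≤ j → Even j → ∫ n in {m : ↥(cmBorelTriple L 3 v).N |
        Valued.v (((((m : ↥(unitaryGroupOfForm (conjLocal L (IsCMField.complexConj L) v) (cmLocalForm L 3 v))) : GL (Fin 3) (LocalRing L v)) : Matrix (Fin 3) (Fin 3) (LocalRing L v)) 0 2) w) = WithZero.exp (j : ℤ) ∧
        Valued.v (((((m : ↥(unitaryGroupOfForm (conjLocal L (IsCMField.complexConj L) v) (cmLocalForm L 3 v))) : GL (Fin 3) (LocalRing L v)) : Matrix (Fin 3) (Fin 3) (LocalRing L v)) 0 1) w) ≤ WithZero.exp ((j : ℤ) - ν)},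
        (fun n : ↥(cmBorelTriple L 3 v).N =>
          if h : IsUnit ((((n : ↥(unitaryGroupOfForm (conjLocal L (IsCMField.complexConj L) v) (cmLocalForm L 3 v))) : GL (Fin 3) (LocalRing L v)) : Matrix (Fin 3) (Fin 3) (LocalRing L v)) 0 2) then
            ((((χ₁ (Units.map ((conjLocal L (IsCMField.complexConj L) v) : LocalRing L v →* LocalRing L v) h.unit))⁻¹ : ℂˣ) : ℂ) *
              ((((unitModulusChar (LocalRing L v) h.unit)⁻¹ : ℝ≥0) : ℝ) : ℂ))
          else 0) n ∂μ = 0) ∧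
    ∃ C : ℂ,
      (∀ j κ : ℕ, j = 2 * κ + 1 → ∫ n in {m : ↥(cmBorelTriple L 3 v).N |
          Valued.v (((((m : ↥(unitaryGroupOfForm (conjLocal L (IsCMField.complexConj L) v) (cmLocalForm L 3 v))) : GL (Fin 3) (LocalRing L v)) : Matrix (Fin 3) (Fin 3) (LocalRing L v)) 0 2) w) = WithZero.exp (j : ℤ) ∧
          Valued.v (((((m : ↥(unitaryGroupOfForm (conjLocal L (IsCMField.complexConj L) v) (cmLocalForm L 3 v))) : GL (Fin 3) (LocalRing L v)) : Matrix (Fin 3) (Fin 3) (LocalRing L v)) 0 1) w) ≤ WithZero.exp ((j : ℤ) - ν)},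
          (fun n : ↥(cmBorelTriple L 3 v).N =>
            if h : IsUnit ((((n : ↥(unitaryGroupOfForm (conjLocal L (IsCMField.complexConj L) v) (cmLocalForm L 3 v))) : GL (Fin 3) (LocalRing L v)) : Matrix (Fin 3) (Fin 3) (LocalRing L v)) 0 2) then
              ((((χ₁ (Units.map ((conjLocal L (IsCMField.complexConj L) v) : LocalRing L v →* LocalRing L v) h.unit))⁻¹ : ℂˣ) : ℂ) *
                ((((unitModulusChar (LocalRing L v) h.unit)⁻¹ : ℝ≥0) : ℝ) : ℂ))
            else 0) n ∂μ =
          C * ((χ₁ (Units.map (conjLocal L (IsCMField.complexConj L) v : LocalRing L v →* LocalRing L v) piU * piU) : ℂˣ) : ℂ) ^ (κ + 1)) ∧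
      C ^ 2 * ((χ₁ (Units.map (conjLocal L (IsCMField.complexConj L) v : LocalRing L v →* LocalRing L v) piU * piU) : ℂˣ) : ℂ) =
        (((Ideal.absNorm w.1.asIdeal : ℝ) : ℂ) ^ ν *
          ((μ.real {m : ↥(cmBorelTriple L 3 v).N | Valued.v (((((m : ↥(unitaryGroupOfForm (conjLocal L (IsCMField.complexConj L) v) (cmLocalForm L 3 v))) : GL (Fin 3) (LocalRing L v)) : Matrix (Fin 3) (Fin 3) (LocalRing L v)) 0 2) w) ≤ Valued.v ϖ ^ (0 : ℕ) ∧
            Valued.v (((((m : ↥(unitaryGroupOfForm (conjLocal L (IsCMField.complexConj L) v) (cmLocalForm L 3 v))) : GL (Fin 3) (LocalRing L v)) : Matrix (Fin 3) (Fin 3) (LocalRing L v)) 0 1) w) ≤ Valued.v ϖ ^ ν} : ℝ) : ℂ)) ^ 2 *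
        ((((Ideal.absNorm w.1.asIdeal : ℝ) : ℂ) - 1) ^ 2 * ((((Ideal.absNorm w.1.asIdeal : ℝ) : ℂ)) ^ (2 * ν + 1))⁻¹) := by
  -- the auxiliary choices: Borel structure of `R`, `Invertible 2`, an additive Haar measure `μ⁻` of `R⁻`
  haveI : SecondCountableTopology (LocalRing L v) := secondCountableTopology_localRing (E := L) v
  letI : MeasurableSpace (LocalRing L v) := borel _
  haveI : BorelSpace (LocalRing L v) := ⟨rfl⟩
  letI : Invertible (2 : LocalRing L v) := (isUnit_two_localRing L v).invertible
  have hσc := continuous_conjLocal L (IsCMField.complexConj L) v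
  haveI := HeisRing.locallyCompactSpace_skewPart (conjLocal L (IsCMField.complexConj L) v) hσc
  haveI : SecondCountableTopology ↥(HeisRing.skewPart (conjLocal L (IsCMField.complexConj L) v)) := TopologicalSpace.Subtype.secondCountableTopology _
  obtain ⟨μY, hμY⟩ : ∃ μ' : Measure ↥(HeisRing.skewPart (conjLocal L (IsCMField.complexConj L) v)), μ' = Measure.addHaar := ⟨_, rfl⟩
  haveI : μY.IsAddHaarMeasure := by rw [hμY]; infer_instance
  haveI : μY.Regular := by rw [hμY]; infer_instance
  -- Branch B ⇒ `hfixP`; `σ½ = ½`; `σ(σΠ·Π) = σΠ·Π`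
  have hfixP := BposRamFixedPrincipalUnits.apply_eq_one_of_branchB_of_fixed_principal_ram L v w h2w χ₁ hB
  have hcσ : conjLocal L (IsCMField.complexConj L) v (⅟ (2 : LocalRing L v)) = ⅟ (2 : LocalRing L v) := HeisRing.map_invOf_two _
  obtain ⟨hlσ, -, -⟩ := BposRamShellFibres.scalingUnit_letters_conj_mul_ram L v w hw he piU hpiU
  -- (T3): the critical value of record and its Gauss square
  obtain ⟨Φcrit, hΦcritC, hΦcrit⟩ := BposRamGaussSphereValues.exists_sphereCrit_sq_mul_eq L v w hw μY he h2w χ₁ h₁ hB hfixP hϖ hm hcond u₁ hu₁ hχu₁ hFε piU hpiU hcσ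
  -- ★ (6d-R) fed (T4), (T3).1, (T5), (T3).2
  exact BposRamShellLawOfRecord.shellLaw_of_values L v w hw hns he h2w hϖ χ₁ h₁ hcontr hB piU hpiU hm hνν u₁ hu₁ hχu₁ μY μ Φcrit
    (BposRamGaussSphereValues.sphere_family_deep_eq_zero L v w hw μY he h2w χ₁ hϖ hcond hFε _ _) hΦcritC
    (BposRamGaussSphereValues.sphere_family_shallow_eq_zero L v w hw μY he h2w χ₁ h₁ hfixP hϖ hm hcond u₁ hu₁ hχu₁ _ hlσ hcσ) hΦcrit

end Summit.HodgeConjecture.HodgeConjecture.R90.S1.BposRamShellLawRb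

end
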